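import Summits.AtomisticToContinuum.Statement
import Mathlib

/-!
# AtomisticToContinuum / CrystalLocalRigidity — assemblies

Route `AtomisticToContinuum/CrystalLocalRigidity` (local optimality of close-packed neighbourhoods
+ rigidity + stacking selection for Lennard-Jones in `ℝ³`). This file records the two purely
logical assembly steps of the route:

* `stmt-AtomisticToContinuum-0624` (summit assembly, shared by all routes): the four conjuncts give
  `AtomisticToContinuum` (the unguarded Literature `HydrodynamicLimit` implies the packing-guarded
  summit conjunct, `HydrodynamicLimit.of_unguarded`; the other three conjuncts are definitional).
* `stmt-AtomisticToContinuum-0622` (crystallization assembly): "the periodic infimum of the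
  Lennard-Jones energy per particle is attained" ∧ "`E(N)/N →` that infimum" ∧ `IsCrystallizing`
  give `Literature.StatMech.Crystallization = HasPeriodicGroundStateEnergy ∧ IsCrystallizing`
  (a least element of the range is the `⨅`).

(`import Mathlib`: sibling signatures of the route are elaborated by the gate in this file's context.)
-/

namespace Literature.StatMech

/-- Settles `stmt-AtomisticToContinuum-0624` (summit assembly): the four conjuncts imply
`AtomisticToContinuum`. Since the statement re-type of 2026-08-16 (D-0032) the summit's first
conjunct is the packing-guarded registry statement `_root_.HydrodynamicLimit`, which the unguarded
Literature conjecture implies (`HydrodynamicLimit.of_unguarded`); the other three conjuncts are the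
Literature statements themselves. [folklore] -/
theorem atomisticToContinuum_of_conjuncts :
    Literature.MathematicalPhysics.KineticTheory.HydrodynamicLimit ∧ Literature.MathematicalPhysics.KineticTheory.HeatConduction.FouriersLaw ∧ Literature.MathematicalPhysics.StatisticalMechanics.Crystallization ∧
      Literature.MathematicalPhysics.QuantumManyBody.BoseGas.BoseEinsteinCondensation → AtomisticToContinuum :=
  fun h => ⟨HydrodynamicLimit.of_unguarded h.1, h.2⟩

/-- Settles `stmt-AtomisticToContinuum-0622` (crystallization assembly of the route): if the
infimum over periodic configurations of `ℝ³` of the Lennard-Jones energy per particle is attained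
by some `P`, the ground-state energy per particle `E(N)/N` converges to that infimum, and
Lennard-Jones ground states crystallize positionally (`IsCrystallizing`), then
`Literature.MathematicalPhysics.StatisticalMechanics.Crystallization` holds: the least value `e(P)` equals `⨅_Q e(Q)`
(`IsLeast.csInf_eq`), so the limit statement is `HasPeriodicGroundStateEnergy`. [folklore] -/
theorem crystallization_of_isLeast_tendsto_isCrystallizing :
    (∃ P : Literature.MathematicalPhysics.StatisticalMechanics.PeriodicConfiguration 3, IsLeast (Set.range fun Q : Literature.MathematicalPhysics.StatisticalMechanics.PeriodicConfiguration 3 => Q.energyPerParticle Literature.MathematicalPhysics.StatisticalMechanics.lennardJones) (P.energyPerParticle Literature.MathematicalPhysics.StatisticalMechanics.lennardJones)) ∧ Filter.Tendsto (fun N : ℕ => Literature.MathematicalPhysics.StatisticalMechanics.groundStateEnergy Literature.MathematicalPhysics.StatisticalMechanics.lennardJones 3 N / N) Filter.atTop (nhds (⨅ Q : Literature.MathematicalPhysics.StatisticalMechanics.PeriodicConfiguration 3, Q.energyPerParticle Literature.MathematicalPhysics.StatisticalMechanics.lennardJones)) ∧ Literature.MathematicalPhysics.StatisticalMechanics.IsCrystallizing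 Literature.MathematicalPhysics.StatisticalMechanics.lennardJones 3 → Literature.MathematicalPhysics.StatisticalMechanics.Crystallization := by
  rintro ⟨⟨P, hP⟩, hT, hC⟩
  refine ⟨⟨P, hP, ?_⟩, hC⟩
  have h : (⨅ Q : Literature.MathematicalPhysics.StatisticalMechanics.PeriodicConfiguration 3, Q.energyPerParticle Literature.MathematicalPhysics.StatisticalMechanics.lennardJones) =
      P.energyPerParticle Literature.MathematicalPhysics.StatisticalMechanics.lennardJones := hP.csInf_eq
  rwa [h] at hT

end Literature.StatMech
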